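import Literature.Probability.RandomPlanarGeometry.LoewnerHullHitting
import Literature.Probability.RandomPlanarGeometry.ArcHullInterior
import HarnessLib

/-!
# `K_T ∩ A ⊂ ∂A`: the closed Loewner hulls first meet a Jordan arc hull on its boundary arc

The first paragraph of the proof of Lemma 6.3 of

* G. F. Lawler, O. Schramm, W. Werner, *Conformal restriction: the chordal case*, J. Amer. Math.
  Soc. **16** (2003) 917–955 (**[LSW]**), p. 14 of arXiv:math/0209343: "We first argue the
  rather obvious fact `K_T ∩ A ⊂ ∂A`" (there by harmonic measure),

PROVED for the hulls bounded by a Jordan arc (`IsArcHull`, in particular for the smooth hulls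
`IsSmoothHull` of `SLERestrictionSmooth`) and an arbitrary continuous driving function, in the
setting of Lemma 6.3 (`T = τ` is the hitting time of `A` by the closed hulls,
`Loewner.IsHullHitTime`, and no real point of `A` is swallowed by time `τ`):

* `Loewner.IsHullHitTime.lt_swallowingTime_of_mem_interior` — **interior points of `A` are not
  swallowed by time `τ`**: the interior of `A` is open, connected (`ArcHullInterior`) and misses
  every `K̂_s`, `s < τ`, so by the dichotomy of wholly swallowed components
  (`Loewner.swallowingTime_eq_or_lt_of_isPreconnected`, Koebe) it is either entirely swallowed at
  time `τ` or not at all — and it accumulates at a real point of `A`, which is alive beyond `τ`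
  together with a neighbourhood (`isOpen_setOf_lt_swallowingTime`);
* `Loewner.IsHullHitTime.closedHull_inter_subset_frontier` — `K̂_τ ∩ A ⊆ ∂A`;
* `Loewner.IsHullHitTime.exists_mem_frontier_swallowingTime_eq` — **there is a hit point
  `z₀ ∈ ℍ ∩ ∂A` swallowed exactly at time `τ`** ([LSW]: "Let `z₀` be some point in
  `∂A ∩ K_T`"), for which `g_t(z₀) - W_t → 0` as `t ↗ τ`
  (`Loewner.tendsto_map_sub_driving_of_swallowingTime_eq`).
-/

noncomputable section

open Set Filter Metric Complex
open _root_.Topology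
open UpperHalfPlane (upperHalfPlaneSet isOpen_upperHalfPlaneSet)
open scoped NNReal

namespace Literature.Probability.RandomPlanarGeometry

namespace Loewner

variable {W : ℝ≥0 → ℝ} {A : Set ℂ} {τ : ℝ≥0}

/-- Before the hitting time nothing of `A` is swallowed: `τ ≤ T_w` for every `w ∈ A`. [folklore] -/
theorem IsHullHitTime.le_swallowingTime (h : IsHullHitTime W A τ) (hA : A ⊆ closure upperHalfPlaneSet)
    {w : ℂ} (hw : w ∈ A) : (τ : WithTop ℝ≥0) ≤ swallowingTime W w := by
  by_contra hlt
  rw [not_le] at hlt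
  obtain ⟨s, hs⟩ := WithTop.ne_top_iff_exists.1 (ne_top_of_lt hlt)
  have hsτ : s < τ := by rw [← hs] at hlt; exact_mod_cast hlt
  have him : 0 ≤ w.im := by
    have := hA hw
    rw [show upperHalfPlaneSet = {z : ℂ | 0 < z.im} from rfl, Complex.closure_setOf_lt_im] at this
    exact this
  have hwK : w ∈ closedHull W s := ⟨him, by rw [← hs]⟩
  exact Set.disjoint_left.1 (h.1 s hsτ) hwK hw

/-- **Interior points of a Jordan arc hull are not swallowed by its hitting time** (continuous
driving function; no real point of `A` swallowed by time `τ`): the interior of `A` is open,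
connected, contained in `ℍ` and alive up to `τ`, so it is wholly swallowed at `τ` or not at all
(`swallowingTime_eq_or_lt_of_isPreconnected`); but it accumulates at a real point of `A`, whose
neighbourhood is alive beyond `τ`. [cite: LawlerSchrammWerner2003Restriction, proof of Lemma 6.3 (first paragraph)] -/
theorem IsHullHitTime.lt_swallowingTime_of_mem_interior (hW : Continuous W) (hA : IsArcHull A)
    (h : IsHullHitTime W A τ)
    (hreal : ∀ x : ℝ, (x : ℂ) ∈ A → ¬ swallowingTime W x ≤ (τ : WithTop ℝ≥0))
    {z : ℂ} (hz : z ∈ interior A) : (τ : WithTop ℝ≥0) < swallowingTime W z := by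
  have hV : ∀ w ∈ interior A, (τ : WithTop ℝ≥0) ≤ swallowingTime W w := fun w hw ↦
    h.le_swallowingTime hA.isBoundedHull.subset_closure (interior_subset hw)
  rcases swallowingTime_eq_or_lt_of_isPreconnected hW isOpen_interior hA.isPreconnected_interior
    hA.isBoundedHull.interior_subset hV with hall | hall
  · exfalso
    obtain ⟨x, hxA, hxcl⟩ := hA.exists_ofReal_mem_closure_interior
    have hxT : (τ : WithTop ℝ≥0) < swallowingTime W x := not_le.1 (hreal x hxA)
    obtain ⟨w, hwT, hwint⟩ := mem_closure_iff_nhds.1 hxcl _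
      ((isOpen_setOf_lt_swallowingTime hW τ).mem_nhds hxT)
    rw [mem_setOf_eq, hall w hwint] at hwT
    exact lt_irrefl _ hwT
  · exact hall z hz

/-- **`K_T ∩ A ⊂ ∂A`** ([LSW] proof of Lemma 6.3, first paragraph) for a Jordan arc hull `A`,
a continuous driving function, the hitting time `τ` of `A` by the closed hulls and no real point
of `A` swallowed by time `τ`. [cite: LawlerSchrammWerner2003Restriction, proof of Lemma 6.3 (first paragraph)] -/
theorem IsHullHitTime.closedHull_inter_subset_frontier (hW : Continuous W) (hA : IsArcHull A)
    (h : IsHullHitTime W A τ)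
    (hreal : ∀ x : ℝ, (x : ℂ) ∈ A → ¬ swallowingTime W x ≤ (τ : WithTop ℝ≥0)) :
    closedHull W τ ∩ A ⊆ frontier A := by
  rintro z ⟨hzK, hzA⟩
  rw [frontier, hA.isBoundedHull.isClosed.closure_eq]
  refine ⟨hzA, fun hint ↦ ?_⟩
  exact lt_irrefl _ ((h.lt_swallowingTime_of_mem_interior hW hA hreal hint).trans_le hzK.2)

/-- **The hit point.** For a Jordan arc hull `A`, a continuous driving function, the hitting
time `τ` of `A` by the closed hulls and no real point of `A` swallowed by time `τ`, there is
`z₀ ∈ A ∩ ℍ ∩ ∂A` — a point of the open boundary arc — swallowed exactly at time `τ`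
(`T_{z₀} = τ`); consequently `g_t(z₀) - W_t → 0` as `t ↗ τ`
(`tendsto_map_sub_driving_of_swallowingTime_eq`). [LSW] proof of Lemma 6.3: "Let `z₀` be some
point in `∂A ∩ K_T`." [cite: LawlerSchrammWerner2003Restriction, proof of Lemma 6.3 (first paragraph)] -/
theorem IsHullHitTime.exists_mem_frontier_swallowingTime_eq (hW : Continuous W) (hA : IsArcHull A)
    (h : IsHullHitTime W A τ)
    (hreal : ∀ x : ℝ, (x : ℂ) ∈ A → ¬ swallowingTime W x ≤ (τ : WithTop ℝ≥0)) :
    ∃ z₀ ∈ A, z₀ ∈ upperHalfPlaneSet ∧ z₀ ∈ frontier A ∧ swallowingTime W z₀ = τ := by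
  obtain ⟨z₀, hzA, hzK⟩ := h.exists_mem_closedHull hW hA.isBoundedHull.isCompact
  refine ⟨z₀, hzA, ?_, h.closedHull_inter_subset_frontier hW hA hreal ⟨hzK, hzA⟩,
    le_antisymm hzK.2 (h.le_swallowingTime hA.isBoundedHull.subset_closure hzA)⟩
  rcases hzK.1.eq_or_lt with h0 | h0
  · exfalso
    have hz : z₀ = ((z₀.re : ℝ) : ℂ) := Complex.ext (by simp) (by simp [← h0])
    rw [hz] at hzA hzK
    exact hreal z₀.re hzA hzK.2
  · exact h0

end Loewner

end Literature.Probability.RandomPlanarGeometry
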